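import Mathlib
import Summits.MatrixMultiplication.MatrixMultiplication.Theses.NilpotentLieHosts

/-!
# MatrixMultiplication / NilpotentLieHosts — support item `DesignsGiveTarget`
(stmt-MatrixMultiplication-7729)

The route decl

  `DesignsGiveTarget : (HeisenbergThresholdDesigns ∨ HigherStepThresholdDesigns) → NilpotentThresholdDesigns`

says that either design crux instantiates the route's design target.

* Heisenberg branch: `HeisenbergThresholdDesigns` is literally the `d := 3` instance of
  `NilpotentThresholdDesigns`, the only difference being the spelling of the threshold exponent:
  `9/2 - δ` versus `(3/4)·d·(d-1) - δ` at `d = 3`, and `(3/4)·3·(3-1) = 9/2`.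
* Higher-step branch: `HigherStepThresholdDesigns` supplies `d ≥ 4` with a body that is verbatim
  the target's body, and `4 ≤ d` gives `3 ≤ d`.

Pure bookkeeping; no mathematics beyond arithmetic on the exponent.

Reference: J. Blasiak, H. Cohn, J. A. Grochow, K. Pratt, C. Umans, *Finite matrix multiplication
algorithms from infinite groups* (arXiv:2410.14905, 2024), Def 2.1 / Thm 2.2 (the notion of
separating polynomials the three statements share).
-/

-- single-conjunct summit: the canonical namespace `Summit.<Summit>.<Sub>.Theorems` repeats the name
set_option linter.dupNamespace false

namespace Summit.MatrixMultiplication.MatrixMultiplication.Theorems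

/-- **Support item `DesignsGiveTarget` of route NilpotentLieHosts** (stmt-MatrixMultiplication-7729),
exact route decl: `(HeisenbergThresholdDesigns ∨ HigherStepThresholdDesigns) → NilpotentThresholdDesigns`.
The Heisenberg design crux is the `d = 3` case of the target (threshold exponent
`(3/4)·3·(3-1) = 9/2`); the higher-step design crux gives a witness `d ≥ 4 ≥ 3` whose body is the
target's verbatim. [cite: BlasiakCohnGrochowPrattUmans2024, Def 2.1] -/
theorem designsGiveTarget_proof :
    Summit.MatrixMultiplication.MatrixMultiplication.Theses.NilpotentLieHosts.DesignsGiveTarget := by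
  unfold Summit.MatrixMultiplication.MatrixMultiplication.Theses.NilpotentLieHosts.DesignsGiveTarget
    Summit.MatrixMultiplication.MatrixMultiplication.Theses.NilpotentLieHosts.HeisenbergThresholdDesigns
    Summit.MatrixMultiplication.MatrixMultiplication.Theses.NilpotentLieHosts.HigherStepThresholdDesigns
    Summit.MatrixMultiplication.MatrixMultiplication.Theses.NilpotentLieHosts.NilpotentThresholdDesigns
  rintro (hH | hS)
  · -- Heisenberg branch: `d := 3`, exponent `(3/4)·3·2 = 9/2`
    refine ⟨3, le_rfl, fun δ hδ s₀ => ?_⟩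
    obtain ⟨s, hs, X, Y, Z, hU, hT, hSep, hV⟩ := hH δ hδ s₀
    refine ⟨s, hs, X, Y, Z, hU, hT, hSep, ?_⟩
    have hexp : (3 : ℝ) / 4 * ((3 : ℕ) : ℝ) * (((3 : ℕ) : ℝ) - 1) - δ = (9 : ℝ) / 2 - δ := by
      norm_num
    rw [hexp]
    exact hV
  · -- higher-step branch: the witness `d ≥ 4` is a witness `d ≥ 3`
    obtain ⟨d, hd4, h⟩ := hS
    exact ⟨d, le_trans (by norm_num) hd4, h⟩

end Summit.MatrixMultiplication.MatrixMultiplication.Theorems
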